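import Literature.NumberTheory.Automorphic.SatakeTransformGLInjective
import Literature.NumberTheory.Automorphic.SatakeParametersGLIsoProofs
import HarnessLib

/-!
# The Satake isomorphism for `GL_n` over any field with a DVR valuation ring and finite residue field
# (the tree's `SatakeGL.satakeAlgEquiv` with its commutativity hypothesis discharged by `isMulCommutative_heckeAlgebra_gl`)

Topic `NumberTheory/Automorphic`; namespace `Literature.NumberTheory.Automorphic` (lane `lit-hodgefound`, Track 2 foundations;
seat `lit-hodgefound-p11`, generation 37, row g37-#18).  One definition with body (`glSatakeAlgEquiv`, an abbreviation of the
tree's `SatakeGL.satakeAlgEquiv` under a discharged hypothesis) + theorems; no named fact, no instance, no notation.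

The tree proves the Satake isomorphism `ℂ[e_1, …, e_n][e_n⁻¹] ≃ₐ[ℂ] ℋ(GL_n(F), GL_n(𝒪))` (`SatakeGL.satakeAlgEquiv`,
`SatakeParametersGLIsoProofs`) for fields `F` with a `ValuativeRel` whose valuation ring is a DVR with finite residue field,
UNDER the hypotheses `[IsHeckeTriple ⊤ K K]` and `[IsMulCommutative ℋ]`, the latter supplied only for non-archimedean local
fields (Gelfand's trick, `isGelfandPair_glInt_holds`).  `SatakeTransformGLInjective` (g37-#15) proves the commutativity for
every such `F` (Satake's route: `𝒮` is injective into a commutative algebra), so the isomorphism holds with only the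
Hecke-pair hypothesis left.

## The print

[CartierCorvallis1979] §IV Thm. 4.1 and §IV.2 Example (`GL_n`); [Macdonald1995] Ch. V (3.4)–(3.5); [Satake1963] §6–§8.

## What is formalised (`F` with `ValuativeRel F`, `𝒪[F]` a DVR, `Finite 𝓀[F]`, `ϖ` uniformizing, `[IsHeckeTriple ⊤ GL_n(𝒪) GL_n(𝒪)]`)

* **`glSatakeAlgEquiv hϖ : symmLaurent n ≃ₐ[ℂ] ℋ(GL_n(F), GL_n(𝒪))`** (`e_r ↦ q^{r(r-1)/2} T_r`), `glSatakeAlgEquiv_apply`.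
* `satakeTransform_comp_glSatakeAlgEquiv` (`𝒮 ∘ θ = ι`, the embedding `ℂ[e][e_n⁻¹] ↪ ℂ[ℤⁿ]`),
  **`range_glSatakeTransform_eq`** (the image of `𝒮` is the image of `ι`, i.e. the symmetric Laurent polynomials),
  **`nonempty_heckeAlgebra_gl_algEquiv_symmLaurent`** (the statement of the tree's `satake_gl`, for every such `F`).

## References
* [CartierCorvallis1979] P. Cartier, *Representations of 𝔭-adic groups: a survey*, PSPM 33.1 (1979), §IV Thm. 4.1, §IV.2.
* [Macdonald1995] I. G. Macdonald, *Symmetric Functions and Hall Polynomials*, 2nd ed. (1995), Ch. V (3.4)–(3.5).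
* [Satake1963] I. Satake, Publ. Math. IHÉS 18 (1963), §§6–8.
-/

noncomputable section

open scoped MatrixGroups
open ValuativeRel

namespace Literature.NumberTheory.Automorphic

universe u

variable {n : ℕ} {F : Type u} [Field F] [ValuativeRel F] [IsDiscreteValuationRing 𝒪[F]] [Finite 𝓀[F]] {ϖ : F}
  [IsHeckeTriple (⊤ : Submonoid (GL (Fin n) F)) (glInt n F) (glInt n F)]

/-- **THE SATAKE ISOMORPHISM FOR `GL_n`** over any field with a DVR valuation ring and finite residue field:
`θ : ℂ[e_1, …, e_n][e_n⁻¹] ≃ₐ[ℂ] ℋ(GL_n(F), GL_n(𝒪))`, `e_r ↦ q^{r(r-1)/2} T_r` — the tree's `SatakeGL.satakeAlgEquiv` with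
its hypothesis `[IsMulCommutative ℋ]` discharged by `isMulCommutative_heckeAlgebra_gl`.
[cite: CartierCorvallis1979, §IV Thm. 4.1, §IV.2 Example] [cite: Macdonald1995, Ch. V (3.4)–(3.5)] -/
def glSatakeAlgEquiv (hϖ : IsUniformizingElement ϖ) : symmLaurent n ≃ₐ[ℂ] heckeAlgebra ℂ (GL (Fin n) F) (glInt n F) :=
  haveI : IsMulCommutative (heckeAlgebra ℂ (GL (Fin n) F) (glInt n F)) := isMulCommutative_heckeAlgebra_gl
  SatakeGL.satakeAlgEquiv n hϖ

/-- `θ` is the tree's inverse Satake map `SatakeGL.satakeInv`. [cite: CartierCorvallis1979, §IV Thm. 4.1] -/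
theorem glSatakeAlgEquiv_apply (hϖ : IsUniformizingElement ϖ) (s : symmLaurent n) :
    glSatakeAlgEquiv (n := n) hϖ s =
      (haveI : IsMulCommutative (heckeAlgebra ℂ (GL (Fin n) F) (glInt n F)) := isMulCommutative_heckeAlgebra_gl
       SatakeGL.satakeInv n hϖ s) :=
  rfl

/-- **`𝒮 ∘ θ = ι`**, `ι : ℂ[e][e_n⁻¹] ↪ ℂ[ℤⁿ]` the embedding `symmLaurentToLaurent`. [cite: CartierCorvallis1979, §IV Thm. 4.1] -/
theorem satakeTransform_comp_glSatakeAlgEquiv (hϖ : IsUniformizingElement ϖ) :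
    (satakeTransform hϖ).comp (glSatakeAlgEquiv (n := n) hϖ).toAlgHom = symmLaurentToLaurent n := by
  haveI : IsMulCommutative (heckeAlgebra ℂ (GL (Fin n) F) (glInt n F)) := isMulCommutative_heckeAlgebra_gl
  exact SatakeGL.satakeTransform_comp_satakeInv hϖ

/-- **The image of the Satake transform is the algebra of symmetric Laurent polynomials** (the image of `ι`): the
SURJECTIVITY half of Cartier's Thm. 4.1 for `GL_n`, now over every field with a DVR valuation ring and finite residue field.
[cite: CartierCorvallis1979, §IV Thm. 4.1] [cite: Macdonald1995, Ch. V (3.4)–(3.5)] -/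
theorem range_glSatakeTransform_eq (hϖ : IsUniformizingElement ϖ) :
    (satakeTransform (n := n) hϖ).range = (symmLaurentToLaurent n).range := by
  apply le_antisymm
  · rintro _ ⟨T, rfl⟩
    obtain ⟨s, rfl⟩ := (glSatakeAlgEquiv (n := n) hϖ).surjective T
    refine ⟨s, ?_⟩
    have h := congrArg (fun φ => φ s) (satakeTransform_comp_glSatakeAlgEquiv (n := n) hϖ)
    exact h.symm
  · rintro _ ⟨s, rfl⟩
    refine ⟨glSatakeAlgEquiv (n := n) hϖ s, ?_⟩
    have h := congrArg (fun φ => φ s) (satakeTransform_comp_glSatakeAlgEquiv (n := n) hϖ)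
    exact h

/-- **`ℋ(GL_n(F), GL_n(𝒪)) ≃ₐ[ℂ] ℂ[e_1, …, e_n][e_n⁻¹]`** for every field `F` with a DVR valuation ring and finite residue
field and `(GL_n(F), GL_n(𝒪))` a Hecke pair — the statement of the tree's `SatakeParametersGL.satake_gl` (there for
non-archimedean local fields). [cite: CartierCorvallis1979, §IV Thm. 4.1, §IV.2 Example] -/
theorem nonempty_heckeAlgebra_gl_algEquiv_symmLaurent :
    Nonempty (heckeAlgebra ℂ (GL (Fin n) F) (glInt n F) ≃ₐ[ℂ] symmLaurent n) := by
  obtain ⟨ϖ, hϖ⟩ := exists_isUniformizingElement (F := F)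
  exact ⟨(glSatakeAlgEquiv (n := n) hϖ).symm⟩

end Literature.NumberTheory.Automorphic

end
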